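import Mathlib
import Summits.Ventures.HodgeRepro2.Hypothesis
import Summits.Ventures.HodgeRepro2.Level

/-!
# Shimura's congruence level `Γ_N` has finite index in `Γ_1` (and is normal there)

Kernel support for the Tier-3 hypothesis shape `IsFiniteIndexSubgroupOf` of `Hypothesis.lean`:
`NonVanishingInput` is stated for the congruence level `shimuraLevel K H 𝔪 N` (Shimura's `Γ_N`
of (4.14)), and `Level.lean` only records the trivial `Γ_N ≤ Γ_N` of finite index.

Setting: `𝔪 ⊆ K^m` an `IsLattice` (finitely generated over `ℤ`, spanning `K^m` over `ℚ`),
`Γ_1 := shimuraLevel K H 𝔪 1` = the elements of `SU(H)` stabilising `𝔪` (the fourth clause of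
`shimuraLevel` is vacuous for `N = 1`), and `Γ_N ⊆ Γ_1` = those acting trivially on `𝔪 / N𝔪`.

* `latticeMultiples 𝔪 N` = `N𝔪` as an additive subgroup of `𝔪`; `𝔪 / N𝔪` is finite for `N ≠ 0`
  (`finite_quotient_latticeMultiples`, from Mathlib's
  `AddSubgroup.finiteIndex_range_nsmulAddMonoidHom_of_fg` on the finitely generated `ℤ`-module `𝔪`).
* `latticeAct 𝔪 γ hγ : 𝔪 →+ 𝔪` = the right action `x ↦ x ᵥ* γ` of a lattice-preserving matrix;
  `reductionAct` = its reduction to `𝔪 / N𝔪`; `levelReduction H 𝔪 N γ` = the same for `γ ∈ Γ_1`.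
* `mem_shimuraLevel_iff_levelReduction_eq_id`: for `γ ∈ Γ_1`, `γ ∈ Γ_N ↔ levelReduction N γ = id`.
* `levelPermHom H 𝔪 N : Γ_1 →* Equiv.Perm (𝔪 / N𝔪)` (`γ ↦` the reduction of `γ⁻¹`, which turns
  the right action into a left one) with kernel `Γ_N.subgroupOf Γ_1` (`levelPermHom_ker`).
* `normal_subgroupOf_shimuraLevel`: `Γ_N ⊴ Γ_1`; `finiteIndex_subgroupOf_shimuraLevel` and
  **`isFiniteIndexSubgroupOf_shimuraLevel_one`**: `[Γ_1 : Γ_N] < ∞` for a lattice `𝔪` and `N ≠ 0`;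
  `isFiniteIndexSubgroupOf_shimuraLevel_of_dvd`: `[Γ_M : Γ_N] < ∞` for `M ∣ N`.

Everything is proved; no new axioms. What stays prose: that `Γ_1` is an arithmetic subgroup
(discrete in `SU(H)(ℝ)`, cocompact for anisotropic `H`) — a printed input, not a kernel statement.
-/

namespace Summit.Ventures.HodgeRepro2.ShimuraData

open Matrix

section Lattice

variable {K : Type*} [Field K] {m : ℕ} (𝔪 : Submodule ℤ (Fin m → K))

/-! ### `N𝔪` and the finiteness of `𝔪 / N𝔪` -/

/-- `N𝔪`: the multiples `N • y` of lattice vectors, as an additive subgroup of the lattice `𝔪`. -/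
abbrev latticeMultiples (N : ℕ) : AddSubgroup 𝔪 := (nsmulAddMonoidHom N : 𝔪 →+ 𝔪).range

/-- Membership in `N𝔪`. -/
theorem mem_latticeMultiples {N : ℕ} {x : 𝔪} :
    x ∈ latticeMultiples 𝔪 N ↔ ∃ y : 𝔪, N • y = x := by
  simp [latticeMultiples, AddMonoidHom.mem_range]

/-- `𝔪 / N𝔪` is finite for a lattice `𝔪` and `N ≠ 0`. -/
theorem finite_quotient_latticeMultiples [NumberField K] (h𝔪 : IsLattice K 𝔪) {N : ℕ}
    (hN : N ≠ 0) :
    Finite (𝔪 ⧸ latticeMultiples 𝔪 N) := by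
  haveI : Module.Finite ℤ 𝔪 := h𝔪.1
  haveI : AddGroup.FG 𝔪 := Module.Finite.iff_addGroup_fg.mp inferInstance
  haveI := AddSubgroup.finiteIndex_range_nsmulAddMonoidHom_of_fg 𝔪 hN
  infer_instance

/-! ### The right action of a lattice-preserving matrix and its reduction mod `N𝔪` -/

/-- The right action `x ↦ x ᵥ* γ` of a lattice-preserving matrix `γ` on the lattice `𝔪`. -/
def latticeAct (γ : Matrix (Fin m) (Fin m) K) (hγ : ∀ x ∈ 𝔪, x ᵥ* γ ∈ 𝔪) : 𝔪 →+ 𝔪 where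
  toFun x := ⟨(x : Fin m → K) ᵥ* γ, hγ x x.2⟩
  map_zero' := by ext; simp
  map_add' x y := by ext; simp [Matrix.add_vecMul]

/-- The underlying vector of `latticeAct 𝔪 γ hγ x` is `x ᵥ* γ`. -/
@[simp] theorem coe_latticeAct (γ : Matrix (Fin m) (Fin m) K) (hγ : ∀ x ∈ 𝔪, x ᵥ* γ ∈ 𝔪)
    (x : 𝔪) : (latticeAct 𝔪 γ hγ x : Fin m → K) = (x : Fin m → K) ᵥ* γ := rfl

/-- Acting by `γ` and then by `γ'` is acting by `γ * γ'` (a right action). -/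
theorem latticeAct_latticeAct (γ γ' : Matrix (Fin m) (Fin m) K) (hγ : ∀ x ∈ 𝔪, x ᵥ* γ ∈ 𝔪)
    (hγ' : ∀ x ∈ 𝔪, x ᵥ* γ' ∈ 𝔪) (hγγ' : ∀ x ∈ 𝔪, x ᵥ* (γ * γ') ∈ 𝔪) (x : 𝔪) :
    latticeAct 𝔪 γ' hγ' (latticeAct 𝔪 γ hγ x) = latticeAct 𝔪 (γ * γ') hγγ' x := by
  ext; simp [Matrix.vecMul_vecMul]

/-- The identity matrix acts trivially. -/
theorem latticeAct_one (h₁ : ∀ x ∈ 𝔪, x ᵥ* (1 : Matrix (Fin m) (Fin m) K) ∈ 𝔪) (x : 𝔪) :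
    latticeAct 𝔪 1 h₁ x = x := by
  ext; simp

/-- The right action preserves `N𝔪` (it is `ℤ`-linear). -/
theorem latticeMultiples_le_comap (N : ℕ) (γ : Matrix (Fin m) (Fin m) K)
    (hγ : ∀ x ∈ 𝔪, x ᵥ* γ ∈ 𝔪) :
    latticeMultiples 𝔪 N ≤ (latticeMultiples 𝔪 N).comap (latticeAct 𝔪 γ hγ) := by
  intro x hx
  obtain ⟨y, rfl⟩ := (mem_latticeMultiples 𝔪).1 hx
  rw [AddSubgroup.mem_comap, map_nsmul]
  exact (mem_latticeMultiples 𝔪).2 ⟨_, rfl⟩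

/-- The reduction mod `N𝔪` of the right action: `x + N𝔪 ↦ x ᵥ* γ + N𝔪` on `𝔪 / N𝔪`. -/
def reductionAct (N : ℕ) (γ : Matrix (Fin m) (Fin m) K) (hγ : ∀ x ∈ 𝔪, x ᵥ* γ ∈ 𝔪) :
    𝔪 ⧸ latticeMultiples 𝔪 N →+ 𝔪 ⧸ latticeMultiples 𝔪 N :=
  QuotientAddGroup.map _ _ (latticeAct 𝔪 γ hγ) (latticeMultiples_le_comap 𝔪 N γ hγ)

/-- `reductionAct` on the class of `x` is the class of `x ᵥ* γ`. -/
@[simp] theorem reductionAct_mk (N : ℕ) (γ : Matrix (Fin m) (Fin m) K)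
    (hγ : ∀ x ∈ 𝔪, x ᵥ* γ ∈ 𝔪) (x : 𝔪) :
    reductionAct 𝔪 N γ hγ (x : 𝔪 ⧸ latticeMultiples 𝔪 N) =
      (latticeAct 𝔪 γ hγ x : 𝔪 ⧸ latticeMultiples 𝔪 N) :=
  QuotientAddGroup.map_mk _ _ _ _ _

/-- Reducing `γ` and then `γ'` is reducing `γ * γ'`. -/
theorem reductionAct_reductionAct (N : ℕ) (γ γ' : Matrix (Fin m) (Fin m) K)
    (hγ : ∀ x ∈ 𝔪, x ᵥ* γ ∈ 𝔪) (hγ' : ∀ x ∈ 𝔪, x ᵥ* γ' ∈ 𝔪)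
    (hγγ' : ∀ x ∈ 𝔪, x ᵥ* (γ * γ') ∈ 𝔪) (q : 𝔪 ⧸ latticeMultiples 𝔪 N) :
    reductionAct 𝔪 N γ' hγ' (reductionAct 𝔪 N γ hγ q) = reductionAct 𝔪 N (γ * γ') hγγ' q := by
  induction q using QuotientAddGroup.induction_on with
  | H x => simp [latticeAct_latticeAct 𝔪 γ γ' hγ hγ' hγγ']

/-- The identity matrix reduces to the identity. -/
theorem reductionAct_one (N : ℕ) (h₁ : ∀ x ∈ 𝔪, x ᵥ* (1 : Matrix (Fin m) (Fin m) K) ∈ 𝔪)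
    (q : 𝔪 ⧸ latticeMultiples 𝔪 N) : reductionAct 𝔪 N 1 h₁ q = q := by
  induction q using QuotientAddGroup.induction_on with
  | H x => simp [latticeAct_one]

end Lattice

section Level

variable {K : Type*} [Field K] [NumberField K] [NumberField.IsCMField K]
variable {m : ℕ} (H : Matrix (Fin m) (Fin m) K) (𝔪 : Submodule ℤ (Fin m → K))

/-! ### The levels `Γ_N ⊆ Γ_1` -/

/-- An element of `shimuraLevel K H 𝔪 N` stabilises the lattice. -/
theorem vecMul_mem_of_mem_shimuraLevel {N : ℕ} {γ : GL (Fin m) K}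
    (hγ : γ ∈ shimuraLevel K H 𝔪 N) :
    ∀ x ∈ 𝔪, x ᵥ* (γ : Matrix (Fin m) (Fin m) K) ∈ 𝔪 := hγ.2.1

/-- `Γ_N ⊆ Γ_M` whenever `M ∣ N`. -/
theorem shimuraLevel_subset_of_dvd {M N : ℕ} (hMN : M ∣ N) :
    shimuraLevel K H 𝔪 N ⊆ shimuraLevel K H 𝔪 M := by
  rintro γ ⟨h₁, h₂, h₃, h₄⟩
  refine ⟨h₁, h₂, h₃, fun x hx => ?_⟩
  obtain ⟨y, hy, hxy⟩ := h₄ x hx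
  obtain ⟨d, rfl⟩ := hMN
  refine ⟨(d : ℤ) • y, 𝔪.smul_mem _ hy, ?_⟩
  rw [hxy, Nat.cast_mul, mul_smul]

/-- `Γ_N ≤ Γ_M` whenever `M ∣ N`, as subgroups. -/
theorem shimuraLevelSubgroup_le_of_dvd {M N : ℕ} (hMN : M ∣ N) :
    shimuraLevelSubgroup K H 𝔪 N ≤ shimuraLevelSubgroup K H 𝔪 M :=
  fun _ hγ => shimuraLevel_subset_of_dvd H 𝔪 hMN hγ

/-- `Γ_N ≤ Γ_1`. -/
theorem shimuraLevelSubgroup_le_one (N : ℕ) :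
    shimuraLevelSubgroup K H 𝔪 N ≤ shimuraLevelSubgroup K H 𝔪 1 :=
  shimuraLevelSubgroup_le_of_dvd H 𝔪 (one_dvd N)

/-- The reduction mod `N𝔪` of `γ ∈ Γ_1`, as a self-map of `𝔪 / N𝔪`. -/
def levelReduction (N : ℕ) (γ : shimuraLevelSubgroup K H 𝔪 1) :
    𝔪 ⧸ latticeMultiples 𝔪 N → 𝔪 ⧸ latticeMultiples 𝔪 N :=
  reductionAct 𝔪 N ((γ : GL (Fin m) K) : Matrix (Fin m) (Fin m) K)
    (vecMul_mem_of_mem_shimuraLevel H 𝔪 γ.2)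

/-- `levelReduction` on the class of `x` is the class of `x ᵥ* γ`. -/
theorem levelReduction_mk (N : ℕ) (γ : shimuraLevelSubgroup K H 𝔪 1) (x : 𝔪) :
    levelReduction H 𝔪 N γ (x : 𝔪 ⧸ latticeMultiples 𝔪 N) =
      (latticeAct 𝔪 _ (vecMul_mem_of_mem_shimuraLevel H 𝔪 γ.2) x :
        𝔪 ⧸ latticeMultiples 𝔪 N) :=
  reductionAct_mk 𝔪 N _ _ x

/-- `levelReduction` is anti-multiplicative (the action is a right action). -/
theorem levelReduction_mul (N : ℕ) (γ γ' : shimuraLevelSubgroup K H 𝔪 1) :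
    levelReduction H 𝔪 N (γ * γ') = levelReduction H 𝔪 N γ' ∘ levelReduction H 𝔪 N γ := by
  funext q
  exact (reductionAct_reductionAct 𝔪 N _ _ _ _ _ q).symm

/-- The identity reduces to the identity. -/
theorem levelReduction_one (N : ℕ) : levelReduction H 𝔪 N 1 = id := by
  funext q
  exact reductionAct_one 𝔪 N _ q

/-- `levelReduction γ⁻¹ ∘ levelReduction γ = id`. -/
theorem levelReduction_inv_comp (N : ℕ) (γ : shimuraLevelSubgroup K H 𝔪 1) :
    levelReduction H 𝔪 N γ⁻¹ ∘ levelReduction H 𝔪 N γ = id := by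
  rw [← levelReduction_mul, mul_inv_cancel, levelReduction_one]

/-- `levelReduction γ ∘ levelReduction γ⁻¹ = id`. -/
theorem levelReduction_comp_inv (N : ℕ) (γ : shimuraLevelSubgroup K H 𝔪 1) :
    levelReduction H 𝔪 N γ ∘ levelReduction H 𝔪 N γ⁻¹ = id := by
  rw [← levelReduction_mul, inv_mul_cancel, levelReduction_one]

/-- For `γ ∈ Γ_1`: `γ ∈ Γ_N` iff `γ` acts trivially on `𝔪 / N𝔪`. -/
theorem mem_shimuraLevel_iff_levelReduction_eq_id (N : ℕ) (γ : shimuraLevelSubgroup K H 𝔪 1) :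
    (γ : GL (Fin m) K) ∈ shimuraLevel K H 𝔪 N ↔ levelReduction H 𝔪 N γ = id := by
  constructor
  · intro h
    funext q
    induction q using QuotientAddGroup.induction_on with
    | H x =>
      rw [levelReduction_mk, id, QuotientAddGroup.eq]
      obtain ⟨y, hy, hxy⟩ := h.2.2.2 x.1 x.2
      refine (mem_latticeMultiples 𝔪).2 ⟨⟨y, hy⟩, Subtype.ext ?_⟩
      simp only [AddSubmonoidClass.coe_nsmul, Submodule.coe_add, Submodule.coe_neg, coe_latticeAct]
      rw [← natCast_zsmul, ← hxy, neg_add_eq_sub]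
  · intro h
    have hγ : (γ : GL (Fin m) K) ∈ shimuraLevel K H 𝔪 1 := γ.2
    refine ⟨hγ.1, hγ.2.1, hγ.2.2.1, fun x hx => ?_⟩
    have hq := congrFun h ((⟨x, hx⟩ : 𝔪) : 𝔪 ⧸ latticeMultiples 𝔪 N)
    rw [levelReduction_mk, id, QuotientAddGroup.eq] at hq
    obtain ⟨y, hy⟩ := (mem_latticeMultiples 𝔪).1 hq
    refine ⟨y, y.2, ?_⟩
    have hy' := congrArg Subtype.val hy
    simp only [AddSubmonoidClass.coe_nsmul, Submodule.coe_add, Submodule.coe_neg, coe_latticeAct]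
      at hy'
    rw [natCast_zsmul, hy', neg_add_eq_sub]

/-! ### `Γ_1 → Perm(𝔪 / N𝔪)` and its kernel `Γ_N` -/

/-- The reduction of `γ ∈ Γ_1` mod `N𝔪` as a permutation of `𝔪 / N𝔪`: the right action
`x ↦ x ᵥ* γ` is turned into a left action by using `γ⁻¹`. -/
def levelPerm (N : ℕ) (γ : shimuraLevelSubgroup K H 𝔪 1) :
    Equiv.Perm (𝔪 ⧸ latticeMultiples 𝔪 N) where
  toFun := levelReduction H 𝔪 N γ⁻¹
  invFun := levelReduction H 𝔪 N γ
  left_inv q := congrFun (levelReduction_comp_inv H 𝔪 N γ) q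
  right_inv q := congrFun (levelReduction_inv_comp H 𝔪 N γ) q

/-- `levelPerm γ` is the reduction of `γ⁻¹`. -/
@[simp] theorem levelPerm_apply (N : ℕ) (γ : shimuraLevelSubgroup K H 𝔪 1)
    (q : 𝔪 ⧸ latticeMultiples 𝔪 N) : levelPerm H 𝔪 N γ q = levelReduction H 𝔪 N γ⁻¹ q := rfl

/-- `Γ_1 → Perm(𝔪 / N𝔪)`, `γ ↦ levelPerm γ`, as a group homomorphism. -/
def levelPermHom (N : ℕ) :
    shimuraLevelSubgroup K H 𝔪 1 →* Equiv.Perm (𝔪 ⧸ latticeMultiples 𝔪 N) where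
  toFun := levelPerm H 𝔪 N
  map_one' := by
    ext q
    simp [levelReduction_one]
  map_mul' γ γ' := by
    ext q
    simp [_root_.mul_inv_rev, levelReduction_mul]

/-- `levelPermHom γ` is the reduction of `γ⁻¹`. -/
@[simp] theorem levelPermHom_apply_apply (N : ℕ) (γ : shimuraLevelSubgroup K H 𝔪 1)
    (q : 𝔪 ⧸ latticeMultiples 𝔪 N) :
    levelPermHom H 𝔪 N γ q = levelReduction H 𝔪 N γ⁻¹ q := rfl

/-- `levelPermHom γ = 1` iff `γ⁻¹` reduces to the identity. -/
theorem levelPermHom_eq_one_iff (N : ℕ) (γ : shimuraLevelSubgroup K H 𝔪 1) :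
    levelPermHom H 𝔪 N γ = 1 ↔ levelReduction H 𝔪 N γ⁻¹ = id := by
  constructor
  · intro h
    funext q
    have := congrArg (fun σ : Equiv.Perm (𝔪 ⧸ latticeMultiples 𝔪 N) => σ q) h
    simpa using this
  · intro h
    ext q
    simp [h]

/-- The kernel of `levelPermHom` is `Γ_N` (inside `Γ_1`). -/
theorem levelPermHom_ker (N : ℕ) :
    (levelPermHom H 𝔪 N).ker =
      (shimuraLevelSubgroup K H 𝔪 N).subgroupOf (shimuraLevelSubgroup K H 𝔪 1) := by
  ext γ
  rw [MonoidHom.mem_ker, Subgroup.mem_subgroupOf, levelPermHom_eq_one_iff,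
    ← mem_shimuraLevel_iff_levelReduction_eq_id]
  exact Subgroup.inv_mem_iff (shimuraLevelSubgroup K H 𝔪 N)

/-- `Γ_N` is normal in `Γ_1`. -/
theorem normal_subgroupOf_shimuraLevel (N : ℕ) :
    ((shimuraLevelSubgroup K H 𝔪 N).subgroupOf (shimuraLevelSubgroup K H 𝔪 1)).Normal := by
  rw [← levelPermHom_ker]
  exact MonoidHom.normal_ker _

/-- `[Γ_1 : Γ_N] < ∞` for a lattice `𝔪` and `N ≠ 0`. -/
theorem finiteIndex_subgroupOf_shimuraLevel (h𝔪 : IsLattice K 𝔪) {N : ℕ} (hN : N ≠ 0) :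
    ((shimuraLevelSubgroup K H 𝔪 N).subgroupOf (shimuraLevelSubgroup K H 𝔪 1)).FiniteIndex := by
  haveI := finite_quotient_latticeMultiples 𝔪 h𝔪 hN
  rw [← levelPermHom_ker]
  exact Subgroup.finiteIndex_ker _

/-- **Shimura's `Γ_N` has finite index in `Γ_1`**: the `IsFiniteIndexSubgroupOf` hypothesis
shape of `Hypothesis.lean`, discharged for every lattice `𝔪` and every `N ≠ 0`. -/
theorem isFiniteIndexSubgroupOf_shimuraLevel_one (h𝔪 : IsLattice K 𝔪) {N : ℕ} (hN : N ≠ 0) :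
    IsFiniteIndexSubgroupOf K (shimuraLevel K H 𝔪 N) (shimuraLevel K H 𝔪 1) :=
  ⟨shimuraLevelSubgroup K H 𝔪 N, shimuraLevelSubgroup K H 𝔪 1, coe_shimuraLevelSubgroup K H 𝔪 N,
    coe_shimuraLevelSubgroup K H 𝔪 1, shimuraLevelSubgroup_le_one H 𝔪 N,
    finiteIndex_subgroupOf_shimuraLevel H 𝔪 h𝔪 hN⟩

/-- `[Γ_M : Γ_N] < ∞` whenever `M ∣ N` and `N ≠ 0` (multiplicativity of the relative index
in the tower `Γ_N ≤ Γ_M ≤ Γ_1`). -/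
theorem isFiniteIndexSubgroupOf_shimuraLevel_of_dvd (h𝔪 : IsLattice K 𝔪) {M N : ℕ}
    (hMN : M ∣ N) (hN : N ≠ 0) :
    IsFiniteIndexSubgroupOf K (shimuraLevel K H 𝔪 N) (shimuraLevel K H 𝔪 M) := by
  refine ⟨shimuraLevelSubgroup K H 𝔪 N, shimuraLevelSubgroup K H 𝔪 M,
    coe_shimuraLevelSubgroup K H 𝔪 N, coe_shimuraLevelSubgroup K H 𝔪 M,
    shimuraLevelSubgroup_le_of_dvd H 𝔪 hMN, ?_⟩
  rw [Subgroup.finiteIndex_iff]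
  intro h0
  apply Subgroup.finiteIndex_iff.mp (finiteIndex_subgroupOf_shimuraLevel H 𝔪 h𝔪 hN)
  change Subgroup.relIndex _ _ = 0
  rw [← Subgroup.relIndex_mul_relIndex _ _ _ (shimuraLevelSubgroup_le_of_dvd H 𝔪 hMN)
    (shimuraLevelSubgroup_le_one H 𝔪 M)]
  have h0' : (shimuraLevelSubgroup K H 𝔪 N).relIndex (shimuraLevelSubgroup K H 𝔪 M) = 0 := h0
  rw [h0', zero_mul]

end Level

end Summit.Ventures.HodgeRepro2.ShimuraData
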